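import Literature.Geometry.Kaehler.ComplexTorusHodgeLieAlgebraSymplecticDimension
import Literature.Geometry.Kaehler.ComplexTorusHodgeGroupProduct
import Literature.Geometry.Kaehler.ComplexTorusZarhinTrick
import Literature.Geometry.Kaehler.ComplexTorusPicardNumberPoincareLength
import HarnessLib

/-!
# The Hodge Lie algebra of products and powers: `𝔥𝔤_ℝ(X₁ × X₂) ⊆ 𝔥𝔤_ℝ(X₁) ⊕ 𝔥𝔤_ℝ(X₂)` (GGK III.B (i) infinitesimally),
# `dim 𝔥𝔤_ℝ(X₁ × X₂) ≤ dim 𝔥𝔤_ℝ(X₁) + dim 𝔥𝔤_ℝ(X₂)`, `dim 𝔥𝔤_ℝ(Xᴺ) = dim 𝔥𝔤_ℝ(X)`; hence, by the dimension criterion,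
# `Hg(Xᴺ) ≠ Sp` (`N ≥ 2`) and `Hg(X₁ × X₂) ≠ Sp` — products and powers are never Hodge-general — and the case `g = 1`

Layer `Literature/Geometry/Kaehler`, namespace `Literature.Geometry.Kaehler.ComplexTorus`; lane `lit-hodgefound` (Track 2
foundations library), Layer A4, prover seat p17 (generation 17), self-proposed row g17-#4 of
`run/shared/lean/pub/lit-hodgefound/SKELETON.md`.  Sequel, BY NAME, of `ComplexTorusHodgeLieAlgebraSymplecticDimension`
(p17 g17-#1: `IsRiemannForm.hodgeGroup_ne_spGroup_iff_finrank_hodgeGroupLie_lt`, `IsRiemannForm.finrank_hodgeGroupLie_le`,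
`IsRiemannForm.hodgeGroup_eq_spGroup_iff_finrank_hodgeGroupLie_eq`, `IsRiemannForm.finrank_skewAdjointMatricesSubmodule_latticeGram`,
`finrank_hodgeGroupComplexLie_eq_finrank_hodgeGroupLie`, `mem_skewAdjointMatricesSubmodule_iff_transpose_mul_add_mul_eq_zero`),
`ComplexTorusHodgeLieAlgebraHodgeClassesOfPowers` (p17 Q1922:
`coe_hodgeGroupLie_pow` — `𝔥𝔤_ℝ(Xᴺ) = Δ_N 𝔥𝔤_ℝ(X)`), `ComplexTorusHodgeGroupProduct` (`prodPeriod`-Hodge group: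
`toBlocks₁₂_eq_zero_of_mem_hodgeGroup_prod`, `toBlocks₂₁_eq_zero_of_mem_hodgeGroup_prod`, `toBlocks₁₁_mem_hodgeGroup`,
`toBlocks₂₂_mem_hodgeGroup` — GGK III.B (i) for the groups), `ComplexTorusLefschetzGroupProduct` (`diagPow`, `diagPow_injective`),
`ComplexTorusZarhinTrick` (`powForm`, `IsRiemannForm.pow`), `ComplexTorusProduct` (`prodForm`, `IsRiemannForm.prod`),
`ComplexTorusPicardNumberPoincareLength` (`finrank_pos_of_nonempty`), `ComplexTorusRationalFormsBasis`
(`card_eq_two_mul_finrank`), `ComplexTorusHodgeGroupLieAlgebraCartan` (p40: `hodgeGroupLie`,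
`mem_hodgeGroupLie_iff`), `Literature.Analysis.Matrix.DetExp` (`hasDerivAt_exp_smul_apply`) and p24's
`Literature.LinearAlgebra.Matrix.CompactClassicalGroupsExpSurjective` (`exp_fromBlocks_zero` — `exp (A ⊕ D) = exp A ⊕ exp D`).
Everything is consumed BY NAME; nothing is restated.  THEOREMS ONLY: no definition, no named fact, no instance / no instance
attribute (`LieRing.ofAssociativeRing` bound by `letI` inside proofs), net debt 0.

## Sources, verbatim

* [GreenGriffithsKerr2012] M. Green, P. Griffiths, M. Kerr, *Mumford–Tate Groups and Domains* (2012), §III.B (p. 72):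
  "(i) `M_{φ₁+φ₂} ⊂ M_{φ₁} × M_{φ₂}`", "the inclusions (i), (ii) are in general not isomorphisms"; §I.B (I.B.3) (the
  diagonal action on `V^{⊕n}`).
* [MoonenZarhin1999LowDim] B. Moonen, Yu. Zarhin, *Hodge classes on abelian varieties of low dimension*, Math. Ann. 315
  (1999), §1 (held `paper:arxiv-math_9901113` p0002): "For `n ≥ 1` we can identify `Hg(Xⁿ)` with `Hg(X)`, acting
  diagonally on `V_{Xⁿ} = (V_X)ⁿ`."
* [Lange2023AbelianVarietiesComplex] H. Lange, *Abelian Varieties over the Complex Numbers* (2023), §7.3.1, proof of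
  Prop. 7.3.2 (pp. 337–338): "Suppose … `Hg(X_J) ≠ Sp(V,E)`. Then its Lie algebra `𝔥𝔤(X_J)` is a proper Lie subalgebra of
  `𝔰𝔭(V,E)` … lower-dimensional"; Cor. 2.4.24 (product polarisations); Prop. 7.3.3.
* [BrockerTomDieck1985] Th. Bröcker, T. tom Dieck, *Representations of Compact Lie Groups*, I (3.2), (3.3) (naturality of
  `exp`), through p24's `exp_fromBlocks_zero`.
* [BolsinovFomenko2004] A. V. Bolsinov, A. T. Fomenko, *Integrable Hamiltonian Systems* (2004), Ch. 1 §1.1 Prop. 1.3 (a):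
  "`Sp(2n,ℝ)` is a non-compact real Lie group of dimension `n(2n+1)`" (the numbers `g(2g+1)` compared in §3).
* [Hall2015] B. C. Hall, *Lie Groups, Lie Algebras, and Representations*, 2nd ed., §3.3 Prop. 3.22 (proof: differentiating
  one-parameter groups at `t = 0`).

## What is proved

* §1 PRODUCTS (every pair of complex tori): `apply_eq_zero_of_forall_exp_smul_apply_eq_zero` (an identically vanishing
  entry of `e^{tZ}` has vanishing generator entry), `toBlocks₁₂_eq_zero_of_mem_hodgeGroupLie_prod` /
  `toBlocks₂₁_eq_zero_of_mem_hodgeGroupLie_prod` / `eq_fromBlocks_of_mem_hodgeGroupLie_prod` (`𝔥𝔤_ℝ(X₁ × X₂)` is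
  block-diagonal), `exp_smul_eq_fromBlocks_of_mem_hodgeGroupLie_prod`, `toBlocks₁₁_mem_hodgeGroupLie` /
  `toBlocks₂₂_mem_hodgeGroupLie`, **`exists_eq_fromBlocks_of_mem_hodgeGroupLie_prod`** / `coe_hodgeGroupLie_prod_subset`
  (GGK III.B (i) INFINITESIMALLY: `𝔥𝔤_ℝ(X₁ × X₂) ⊆ 𝔥𝔤_ℝ(X₁) ⊕ 𝔥𝔤_ℝ(X₂)`), **`finrank_hodgeGroupLie_prod_le`**
  (`dim_ℝ 𝔥𝔤_ℝ(X₁ × X₂) ≤ dim_ℝ 𝔥𝔤_ℝ(X₁) + dim_ℝ 𝔥𝔤_ℝ(X₂)`).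
* §2 POWERS (every torus, `N ≥ 1`): **`finrank_hodgeGroupLie_pow`** (`dim_ℝ 𝔥𝔤_ℝ(Xᴺ) = dim_ℝ 𝔥𝔤_ℝ(X)`),
  `finrank_hodgeGroupComplexLie_pow` (`dim_ℂ Lie(Hg(Xᴺ)(ℂ)) = dim_ℂ Lie(Hg(X)(ℂ))`).
* §3 NEVER HODGE-GENERAL (polarised tori): `finrank_pi_fin`, `mul_two_mul_add_one_lt` (`g(2g+1) < Ng(2Ng+1)`),
  `mul_two_mul_add_one_add_lt` (`g₁(2g₁+1) + g₂(2g₂+1) < (g₁+g₂)(2(g₁+g₂)+1)`), `IsRiemannForm.finrank_hodgeGroupLie_pow_lt`,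
  **`IsRiemannForm.hodgeGroup_pow_ne_spGroup`** (`Hg(Xᴺ) ≠ Sp(Vᴺ, Eᴺ)`, `g ≥ 1`, `N ≥ 2`),
  `IsRiemannForm.finrank_hodgeGroupLie_prod_lt`, **`IsRiemannForm.hodgeGroup_prod_ne_spGroup`** (`Hg(X₁ × X₂) ≠
  Sp(V₁ ⊕ V₂, E₁ ⊞ E₂)`, `g₁, g₂ ≥ 1`).
* §4 `g = 1`, first half: `card_eq_two_of_dimOne` (`|ι| = 2`), `IsRiemannForm.finrank_skewAdjointMatricesSubmodule_latticeGram_of_dimOne`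
  (`dim_ℝ 𝔰𝔭(V, E) = 3`).  The junction with g17-#2 `ComplexTorusEllipticCurveHodgeLieAlgebra` (`𝔰𝔭(V, E) = 𝔰𝔩₂(ℝ)`,
  `Hg(E_τ) = Sp ⟺ End(E_τ) = ℤ` read off the dimensions, `dim 𝔥𝔤_ℝ(E_τᴺ) ∈ {1, 3}`) is deferred to the sequel
  `ComplexTorusHodgeLieAlgebraIsogenyInvariants` (g17-#6), so that this file imports only modules the farm has built.

NOT here: the surjectivity `𝔥𝔤_ℝ(X₁ × X₂) ↠ 𝔥𝔤_ℝ(X_i)` and `dim 𝔥𝔤_ℝ(X₁ × X₂) ≥ max dim 𝔥𝔤_ℝ(X_i)`; products of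
isogenous / non-isogenous factors (`𝔥𝔤_ℝ(X × X) = Δ 𝔥𝔤_ℝ(X)` on `prodPeriod` vs `powPeriod`); the Mumford–Tate versions.
-/

noncomputable section

open scoped Matrix

open Set Function Matrix Module NormedSpace

namespace Literature.Geometry.Kaehler

namespace ComplexTorus

/-! ## §1 Products: `𝔥𝔤_ℝ(X₁ × X₂) ⊆ 𝔥𝔤_ℝ(X₁) ⊕ 𝔥𝔤_ℝ(X₂)` and `dim 𝔥𝔤_ℝ(X₁ × X₂) ≤ dim 𝔥𝔤_ℝ(X₁) + dim 𝔥𝔤_ℝ(X₂)` -/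

section Product

variable {ι₁ ι₂ : Type*} [Fintype ι₁] [Fintype ι₂] [DecidableEq ι₁] [DecidableEq ι₂]
  {E₁ E₂ : Type*} [NormedAddCommGroup E₁] [NormedSpace ℂ E₁] [NormedAddCommGroup E₂] [NormedSpace ℂ E₂]
  (Φ₁ : (ι₁ → ℝ) ≃L[ℝ] E₁) (Φ₂ : (ι₂ → ℝ) ≃L[ℝ] E₂)

/-- An entry of a one-parameter group which vanishes identically has vanishing generator entry:
`(e^{tZ})_{pq} = 0` for all `t` ⟹ `Z_{pq} = 0` (differentiate at `t = 0`). [cite: Hall2015, §3.3 Prop. 3.22 (proof)] -/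
theorem apply_eq_zero_of_forall_exp_smul_apply_eq_zero {κ : Type*} [Fintype κ] [DecidableEq κ] {Z : Matrix κ κ ℝ}
    {p q : κ} (h : ∀ t : ℝ, exp (t • Z) p q = 0) : Z p q = 0 := by
  have h1 := Literature.Analysis.Matrix.hasDerivAt_exp_smul_apply Z p q 0
  rw [zero_smul, exp_zero, Matrix.one_mul] at h1
  have hfun : (fun u : ℝ ↦ exp (u • Z) p q) = fun _ ↦ (0 : ℝ) := funext h
  rw [hfun] at h1
  exact h1.unique (hasDerivAt_const 0 (0 : ℝ))

/-- **`Z ∈ 𝔥𝔤_ℝ(X₁ × X₂)` has vanishing block `Z₁₂`** (the one-parameter group `e^{tZ} ⊆ Hg(X₁ × X₂)(ℝ) ⊆ Hg(X₁) × Hg(X₂)`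
is block-diagonal). [cite: GreenGriffithsKerr2012, §III.B (i) (p. 72: "`M_{φ₁+φ₂} ⊂ M_{φ₁} × M_{φ₂}`")] -/
theorem toBlocks₁₂_eq_zero_of_mem_hodgeGroupLie_prod {Z : Matrix (ι₁ ⊕ ι₂) (ι₁ ⊕ ι₂) ℝ}
    (hZ : Z ∈ hodgeGroupLie (prodPeriod Φ₁ Φ₂)) : Z.toBlocks₁₂ = 0 := by
  ext i j
  refine apply_eq_zero_of_forall_exp_smul_apply_eq_zero fun t ↦ ?_
  obtain ⟨M, hM, hMt⟩ := (mem_hodgeGroupLie_iff _).1 hZ t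
  have h := congrFun (congrFun (toBlocks₁₂_eq_zero_of_mem_hodgeGroup_prod Φ₁ Φ₂ hM) i) j
  rwa [hMt] at h

/-- **`Z ∈ 𝔥𝔤_ℝ(X₁ × X₂)` has vanishing block `Z₂₁`.** [cite: GreenGriffithsKerr2012, §III.B (i) (p. 72)] -/
theorem toBlocks₂₁_eq_zero_of_mem_hodgeGroupLie_prod {Z : Matrix (ι₁ ⊕ ι₂) (ι₁ ⊕ ι₂) ℝ}
    (hZ : Z ∈ hodgeGroupLie (prodPeriod Φ₁ Φ₂)) : Z.toBlocks₂₁ = 0 := by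
  ext i j
  refine apply_eq_zero_of_forall_exp_smul_apply_eq_zero fun t ↦ ?_
  obtain ⟨M, hM, hMt⟩ := (mem_hodgeGroupLie_iff _).1 hZ t
  have h := congrFun (congrFun (toBlocks₂₁_eq_zero_of_mem_hodgeGroup_prod Φ₁ Φ₂ hM) i) j
  rwa [hMt] at h

/-- `Z ∈ 𝔥𝔤_ℝ(X₁ × X₂)` is the block-diagonal matrix of its diagonal blocks. [cite: GreenGriffithsKerr2012, §III.B (i) (p. 72)] -/
theorem eq_fromBlocks_of_mem_hodgeGroupLie_prod {Z : Matrix (ι₁ ⊕ ι₂) (ι₁ ⊕ ι₂) ℝ}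
    (hZ : Z ∈ hodgeGroupLie (prodPeriod Φ₁ Φ₂)) : Z = Matrix.fromBlocks Z.toBlocks₁₁ 0 0 Z.toBlocks₂₂ := by
  conv_lhs => rw [← Matrix.fromBlocks_toBlocks Z, toBlocks₁₂_eq_zero_of_mem_hodgeGroupLie_prod Φ₁ Φ₂ hZ,
    toBlocks₂₁_eq_zero_of_mem_hodgeGroupLie_prod Φ₁ Φ₂ hZ]

/-- `e^{tZ} = (e^{tZ₁₁} 0; 0 e^{tZ₂₂})` for `Z ∈ 𝔥𝔤_ℝ(X₁ × X₂)`. [cite: BrockerTomDieck1985, I (3.2) (`exp (A ⊕ D) = exp A ⊕ exp D`)] -/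
theorem exp_smul_eq_fromBlocks_of_mem_hodgeGroupLie_prod {Z : Matrix (ι₁ ⊕ ι₂) (ι₁ ⊕ ι₂) ℝ}
    (hZ : Z ∈ hodgeGroupLie (prodPeriod Φ₁ Φ₂)) (t : ℝ) :
    exp (t • Z) = Matrix.fromBlocks (exp (t • Z.toBlocks₁₁)) 0 0 (exp (t • Z.toBlocks₂₂)) := by
  conv_lhs => rw [eq_fromBlocks_of_mem_hodgeGroupLie_prod Φ₁ Φ₂ hZ, Matrix.fromBlocks_smul, smul_zero, smul_zero]
  exact Literature.LinearAlgebra.Matrix.exp_fromBlocks_zero (t • Z.toBlocks₁₁) (t • Z.toBlocks₂₂)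

/-- **The block `Z₁₁` of `Z ∈ 𝔥𝔤_ℝ(X₁ × X₂)` lies in `𝔥𝔤_ℝ(X₁)`** (`e^{tZ₁₁}` is the `(1,1)`-block of
`e^{tZ} ∈ Hg(X₁ × X₂)(ℝ)`, which lies in `Hg(X₁)(ℝ)`). [cite: GreenGriffithsKerr2012, §III.B (i) (p. 72)] -/
theorem toBlocks₁₁_mem_hodgeGroupLie {Z : Matrix (ι₁ ⊕ ι₂) (ι₁ ⊕ ι₂) ℝ}
    (hZ : Z ∈ hodgeGroupLie (prodPeriod Φ₁ Φ₂)) : Z.toBlocks₁₁ ∈ hodgeGroupLie Φ₁ := by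
  refine (mem_hodgeGroupLie_iff _).2 fun t ↦ ?_
  obtain ⟨M, hM, hMt⟩ := (mem_hodgeGroupLie_iff _).1 hZ t
  refine ⟨_, toBlocks₁₁_mem_hodgeGroup Φ₁ Φ₂ hM, ?_⟩
  change M.1.toBlocks₁₁ = exp (t • Z.toBlocks₁₁)
  rw [hMt, exp_smul_eq_fromBlocks_of_mem_hodgeGroupLie_prod Φ₁ Φ₂ hZ, Matrix.toBlocks_fromBlocks₁₁]

/-- **The block `Z₂₂` of `Z ∈ 𝔥𝔤_ℝ(X₁ × X₂)` lies in `𝔥𝔤_ℝ(X₂)`.** [cite: GreenGriffithsKerr2012, §III.B (i) (p. 72)] -/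
theorem toBlocks₂₂_mem_hodgeGroupLie {Z : Matrix (ι₁ ⊕ ι₂) (ι₁ ⊕ ι₂) ℝ}
    (hZ : Z ∈ hodgeGroupLie (prodPeriod Φ₁ Φ₂)) : Z.toBlocks₂₂ ∈ hodgeGroupLie Φ₂ := by
  refine (mem_hodgeGroupLie_iff _).2 fun t ↦ ?_
  obtain ⟨M, hM, hMt⟩ := (mem_hodgeGroupLie_iff _).1 hZ t
  refine ⟨_, toBlocks₂₂_mem_hodgeGroup Φ₁ Φ₂ hM, ?_⟩
  change M.1.toBlocks₂₂ = exp (t • Z.toBlocks₂₂)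
  rw [hMt, exp_smul_eq_fromBlocks_of_mem_hodgeGroupLie_prod Φ₁ Φ₂ hZ, Matrix.toBlocks_fromBlocks₂₂]

/-- **GGK III.B (i) INFINITESIMALLY: `𝔥𝔤_ℝ(X₁ × X₂) ⊆ 𝔥𝔤_ℝ(X₁) ⊕ 𝔥𝔤_ℝ(X₂)`** (block-diagonally embedded), for every
pair of complex tori — every `Z ∈ 𝔥𝔤_ℝ(X₁ × X₂)` is `(A 0; 0 B)` with `A ∈ 𝔥𝔤_ℝ(X₁)`, `B ∈ 𝔥𝔤_ℝ(X₂)`.  (The inclusion is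
strict in general, as for the groups.) [cite: GreenGriffithsKerr2012, §III.B (i) (p. 72: "`M_{φ₁+φ₂} ⊂ M_{φ₁} × M_{φ₂}` … the inclusions (i), (ii) are in general not isomorphisms")] -/
theorem exists_eq_fromBlocks_of_mem_hodgeGroupLie_prod {Z : Matrix (ι₁ ⊕ ι₂) (ι₁ ⊕ ι₂) ℝ}
    (hZ : Z ∈ hodgeGroupLie (prodPeriod Φ₁ Φ₂)) :
    ∃ A ∈ hodgeGroupLie Φ₁, ∃ B ∈ hodgeGroupLie Φ₂, Z = Matrix.fromBlocks A 0 0 B :=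
  ⟨_, toBlocks₁₁_mem_hodgeGroupLie Φ₁ Φ₂ hZ, _, toBlocks₂₂_mem_hodgeGroupLie Φ₁ Φ₂ hZ,
    eq_fromBlocks_of_mem_hodgeGroupLie_prod Φ₁ Φ₂ hZ⟩

/-- The same as an inclusion of sets of matrices. [cite: GreenGriffithsKerr2012, §III.B (i) (p. 72)] -/
theorem coe_hodgeGroupLie_prod_subset :
    (hodgeGroupLie (prodPeriod Φ₁ Φ₂) : Set (Matrix (ι₁ ⊕ ι₂) (ι₁ ⊕ ι₂) ℝ)) ⊆
      (fun AB : Matrix ι₁ ι₁ ℝ × Matrix ι₂ ι₂ ℝ ↦ Matrix.fromBlocks AB.1 0 0 AB.2) ''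
        ((hodgeGroupLie Φ₁ : Set (Matrix ι₁ ι₁ ℝ)) ×ˢ (hodgeGroupLie Φ₂ : Set (Matrix ι₂ ι₂ ℝ))) := by
  intro Z hZ
  obtain ⟨A, hA, B, hB, hZe⟩ := exists_eq_fromBlocks_of_mem_hodgeGroupLie_prod Φ₁ Φ₂ hZ
  exact ⟨(A, B), Set.mk_mem_prod hA hB, hZe.symm⟩

/-- **`dim_ℝ 𝔥𝔤_ℝ(X₁ × X₂) ≤ dim_ℝ 𝔥𝔤_ℝ(X₁) + dim_ℝ 𝔥𝔤_ℝ(X₂)`** for every pair of complex tori (`Z ↦ (Z₁₁, Z₂₂)` is an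
injective linear map `𝔥𝔤_ℝ(X₁ × X₂) → 𝔥𝔤_ℝ(X₁) × 𝔥𝔤_ℝ(X₂)`). [cite: GreenGriffithsKerr2012, §III.B (i) (p. 72)] -/
theorem finrank_hodgeGroupLie_prod_le :
    finrank ℝ (hodgeGroupLie (prodPeriod Φ₁ Φ₂)) ≤ finrank ℝ (hodgeGroupLie Φ₁) + finrank ℝ (hodgeGroupLie Φ₂) := by
  letI : LieRing (Matrix ι₁ ι₁ ℝ) := LieRing.ofAssociativeRing
  letI : LieRing (Matrix ι₂ ι₂ ℝ) := LieRing.ofAssociativeRing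
  letI : LieRing (Matrix (ι₁ ⊕ ι₂) (ι₁ ⊕ ι₂) ℝ) := LieRing.ofAssociativeRing
  let f : hodgeGroupLie (prodPeriod Φ₁ Φ₂) →ₗ[ℝ] hodgeGroupLie Φ₁ × hodgeGroupLie Φ₂ :=
    { toFun := fun Z ↦ (⟨(Z : Matrix (ι₁ ⊕ ι₂) (ι₁ ⊕ ι₂) ℝ).toBlocks₁₁, toBlocks₁₁_mem_hodgeGroupLie Φ₁ Φ₂ Z.2⟩,
        ⟨(Z : Matrix (ι₁ ⊕ ι₂) (ι₁ ⊕ ι₂) ℝ).toBlocks₂₂, toBlocks₂₂_mem_hodgeGroupLie Φ₁ Φ₂ Z.2⟩)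
      map_add' := fun Z W ↦ rfl
      map_smul' := fun c Z ↦ rfl }
  have hf : Function.Injective f := by
    intro Z W h
    apply Subtype.ext
    have h1 : (Z : Matrix (ι₁ ⊕ ι₂) (ι₁ ⊕ ι₂) ℝ).toBlocks₁₁ = (W : Matrix (ι₁ ⊕ ι₂) (ι₁ ⊕ ι₂) ℝ).toBlocks₁₁ :=
      congrArg (fun x ↦ (x.1 : Matrix ι₁ ι₁ ℝ)) h
    have h2 : (Z : Matrix (ι₁ ⊕ ι₂) (ι₁ ⊕ ι₂) ℝ).toBlocks₂₂ = (W : Matrix (ι₁ ⊕ ι₂) (ι₁ ⊕ ι₂) ℝ).toBlocks₂₂ :=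
      congrArg (fun x ↦ (x.2 : Matrix ι₂ ι₂ ℝ)) h
    rw [eq_fromBlocks_of_mem_hodgeGroupLie_prod Φ₁ Φ₂ Z.2, eq_fromBlocks_of_mem_hodgeGroupLie_prod Φ₁ Φ₂ W.2, h1, h2]
  have h := LinearMap.finrank_le_finrank_of_injective hf
  rwa [Module.finrank_prod] at h

end Product

/-! ## §2 Powers: `dim_ℝ 𝔥𝔤_ℝ(Xᴺ) = dim_ℝ 𝔥𝔤_ℝ(X)` -/

section Power

variable {ι : Type*} [Fintype ι] [DecidableEq ι] {E : Type*} [NormedAddCommGroup E] [NormedSpace ℂ E]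
  (Φ : (ι → ℝ) ≃L[ℝ] E)

/-- **`dim_ℝ 𝔥𝔤_ℝ(Xᴺ) = dim_ℝ 𝔥𝔤_ℝ(X)` for `N ≥ 1`**: `𝔥𝔤_ℝ(Xᴺ) = Δ_N 𝔥𝔤_ℝ(X)` (Q1922's `coe_hodgeGroupLie_pow`) and the
diagonal embedding `Δ_N : A ↦ 1_N ⊗ A` is injective and linear.
[cite: MoonenZarhin1999LowDim, §1 ("For `n ≥ 1` we can identify `Hg(Xⁿ)` with `Hg(X)`, acting diagonally")] [cite: GreenGriffithsKerr2012, §I.B (I.B.3)] -/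
theorem finrank_hodgeGroupLie_pow {N : ℕ} (hN : 0 < N) :
    finrank ℝ (hodgeGroupLie (powPeriod Φ N)) = finrank ℝ (hodgeGroupLie Φ) := by
  letI : LieRing (Matrix ι ι ℝ) := LieRing.ofAssociativeRing
  letI : LieRing (Matrix (Fin N × ι) (Fin N × ι) ℝ) := LieRing.ofAssociativeRing
  have hmap : (hodgeGroupLie (powPeriod Φ N)).toSubmodule =
      (hodgeGroupLie Φ).toSubmodule.map (diagPow ι N).toLinearMap := by
    refine SetLike.coe_injective ?_
    rw [Submodule.map_coe, LieSubalgebra.coe_toSubmodule, LieSubalgebra.coe_toSubmodule, coe_hodgeGroupLie_pow Φ hN]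
    rfl
  change finrank ℝ (hodgeGroupLie (powPeriod Φ N)).toSubmodule = finrank ℝ (hodgeGroupLie Φ).toSubmodule
  rw [hmap]
  exact (Submodule.equivMapOfInjective _ (diagPow_injective N hN) _).finrank_eq.symm

/-- **`dim_ℂ Lie(Hg(Xᴺ)(ℂ)) = dim_ℂ Lie(Hg(X)(ℂ))` for `N ≥ 1`** (through `dim_ℂ 𝔤 = dim_ℝ 𝔥𝔤_ℝ`, g17-#1).
[cite: MoonenZarhin1999LowDim, §1] [cite: GreenGriffithsKerr2012, §II.C, Lemma after (II.C.1) ("`𝒜_ℂ = 𝒜 ⊗ ℂ`")] -/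
theorem finrank_hodgeGroupComplexLie_pow {N : ℕ} (hN : 0 < N) :
    finrank ℂ (hodgeGroupComplexLie (powPeriod Φ N)) = finrank ℂ (hodgeGroupComplexLie Φ) := by
  rw [finrank_hodgeGroupComplexLie_eq_finrank_hodgeGroupLie, finrank_hodgeGroupComplexLie_eq_finrank_hodgeGroupLie,
    finrank_hodgeGroupLie_pow Φ hN]

end Power

/-! ## §3 Products and powers are never Hodge-general: `Hg(Xᴺ) ≠ Sp` (`N ≥ 2`), `Hg(X₁ × X₂) ≠ Sp` -/

section NotGeneral

variable {ι : Type*} [Fintype ι] [DecidableEq ι] {E : Type*} [NormedAddCommGroup E] [NormedSpace ℂ E]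
  {Φ : (ι → ℝ) ≃L[ℝ] E}

omit [DecidableEq ι] in
/-- `dim_ℂ Eᴺ = N · dim_ℂ E`. [cite: Lange2023AbelianVarietiesComplex, §1.1.1] -/
theorem finrank_pi_fin [FiniteDimensional ℂ E] (N : ℕ) : finrank ℂ (Fin N → E) = N * finrank ℂ E := by
  rw [Module.finrank_pi_fintype, Finset.sum_const, Finset.card_univ, Fintype.card_fin, smul_eq_mul]

/-- `g(2g+1) < Ng(2Ng+1)` for `g ≥ 1`, `N ≥ 2` (`dim Sp_{2g} < dim Sp_{2Ng}`). [cite: BolsinovFomenko2004, Ch. 1 §1.1 Prop. 1.3 (a)] -/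
theorem mul_two_mul_add_one_lt {g N : ℕ} (hg : 0 < g) (hN : 2 ≤ N) :
    g * (2 * g + 1) < N * g * (2 * (N * g) + 1) := by
  have h1 : 2 * g ≤ N * g := Nat.mul_le_mul_right g hN
  have h2 : g * (2 * g + 1) < 2 * g * (2 * g + 1) := by nlinarith
  calc g * (2 * g + 1) < 2 * g * (2 * g + 1) := h2
    _ ≤ N * g * (2 * (N * g) + 1) := Nat.mul_le_mul h1 (by omega)

/-- **`dim_ℝ 𝔥𝔤_ℝ(Xᴺ) < dim Sp(Vᴺ, Eᴺ) = Ng(2Ng+1)` for a polarised torus `X` of dimension `g ≥ 1` and `N ≥ 2`**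
(`dim 𝔥𝔤_ℝ(Xᴺ) = dim 𝔥𝔤_ℝ(X) ≤ g(2g+1)`). [cite: MoonenZarhin1999LowDim, §1] [cite: Lange2023AbelianVarietiesComplex, §7.3.1, proof of Prop. 7.3.2 (pp. 337–338)] -/
theorem IsRiemannForm.finrank_hodgeGroupLie_pow_lt [FiniteDimensional ℂ E] [Nonempty ι] {η : E [⋀^Fin 2]→L[ℝ] ℝ}
    (hη : IsRiemannForm Φ η) {N : ℕ} (hN : 2 ≤ N) :
    finrank ℝ (hodgeGroupLie (powPeriod Φ N)) < finrank ℂ (Fin N → E) * (2 * finrank ℂ (Fin N → E) + 1) := by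
  rw [finrank_hodgeGroupLie_pow Φ (by omega), finrank_pi_fin]
  exact lt_of_le_of_lt hη.finrank_hodgeGroupLie_le (mul_two_mul_add_one_lt (finrank_pos_of_nonempty Φ) hN)

/-- **POWERS ARE NEVER HODGE-GENERAL: `Hg(Xᴺ) ≠ Sp(Vᴺ, Eᴺ)` for every polarised complex torus `(X, E)` of dimension
`g ≥ 1` and every `N ≥ 2`** (`Eᴺ = ⊞ᴺ E` the product polarisation) — by the dimension criterion of g17-#1: the Lie
algebra `𝔥𝔤_ℝ(Xᴺ) ≅ 𝔥𝔤_ℝ(X)` is too small.  (Consistent with Prop. 7.3.3: `X × X` carries the graph classes, so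
`H^{2p}_Hodge(X²) ≠ ℚ·E^p`.) [cite: Lange2023AbelianVarietiesComplex, §7.3.1, proof of Prop. 7.3.2 (p. 337: "`Hg(X_J) ≠ Sp(V,E)` … `𝔥𝔤(X_J)` is a proper Lie subalgebra of `𝔰𝔭(V,E)`") and Prop. 7.3.3]
[cite: MoonenZarhin1999LowDim, §1 ("we can identify `Hg(Xⁿ)` with `Hg(X)`")] -/
theorem IsRiemannForm.hodgeGroup_pow_ne_spGroup [FiniteDimensional ℂ E] [Nonempty ι] {η : E [⋀^Fin 2]→L[ℝ] ℝ}
    (hη : IsRiemannForm Φ η) {N : ℕ} (hN : 2 ≤ N) :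
    hodgeGroup (powPeriod Φ N) ≠ spGroup (powPeriod Φ N) (powForm η N) :=
  (hη.pow N).hodgeGroup_ne_spGroup_iff_finrank_hodgeGroupLie_lt.2 (hη.finrank_hodgeGroupLie_pow_lt hN)

variable {ι₁ ι₂ : Type*} [Fintype ι₁] [Fintype ι₂] [DecidableEq ι₁] [DecidableEq ι₂]
  {E₁ E₂ : Type*} [NormedAddCommGroup E₁] [NormedSpace ℂ E₁] [NormedAddCommGroup E₂] [NormedSpace ℂ E₂]
  {Φ₁ : (ι₁ → ℝ) ≃L[ℝ] E₁} {Φ₂ : (ι₂ → ℝ) ≃L[ℝ] E₂}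

/-- `g₁(2g₁+1) + g₂(2g₂+1) < (g₁+g₂)(2(g₁+g₂)+1)` for `g₁, g₂ ≥ 1` (the difference is `4g₁g₂`):
`dim Sp_{2g₁} × Sp_{2g₂} < dim Sp_{2(g₁+g₂)}`. [cite: BolsinovFomenko2004, Ch. 1 §1.1 Prop. 1.3 (a)] -/
theorem mul_two_mul_add_one_add_lt {g₁ g₂ : ℕ} (h₁ : 0 < g₁) (h₂ : 0 < g₂) :
    g₁ * (2 * g₁ + 1) + g₂ * (2 * g₂ + 1) < (g₁ + g₂) * (2 * (g₁ + g₂) + 1) := by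
  nlinarith

/-- **`dim_ℝ 𝔥𝔤_ℝ(X₁ × X₂) < dim Sp(V₁ ⊕ V₂, E₁ ⊞ E₂)`** for polarised tori of dimensions `g₁, g₂ ≥ 1`
(`dim 𝔥𝔤_ℝ(X₁ × X₂) ≤ g₁(2g₁+1) + g₂(2g₂+1) < (g₁+g₂)(2(g₁+g₂)+1)`). [cite: GreenGriffithsKerr2012, §III.B (i) (p. 72)]
[cite: Lange2023AbelianVarietiesComplex, §7.3.1, proof of Prop. 7.3.2 (pp. 337–338)] -/
theorem IsRiemannForm.finrank_hodgeGroupLie_prod_lt [FiniteDimensional ℂ E₁] [FiniteDimensional ℂ E₂] [Nonempty ι₁]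
    [Nonempty ι₂] {ω₁ : E₁ [⋀^Fin 2]→L[ℝ] ℝ} {ω₂ : E₂ [⋀^Fin 2]→L[ℝ] ℝ} (h₁ : IsRiemannForm Φ₁ ω₁)
    (h₂ : IsRiemannForm Φ₂ ω₂) :
    finrank ℝ (hodgeGroupLie (prodPeriod Φ₁ Φ₂)) < finrank ℂ (E₁ × E₂) * (2 * finrank ℂ (E₁ × E₂) + 1) := by
  rw [Module.finrank_prod]
  exact lt_of_le_of_lt (le_trans (finrank_hodgeGroupLie_prod_le Φ₁ Φ₂)
    (add_le_add h₁.finrank_hodgeGroupLie_le h₂.finrank_hodgeGroupLie_le))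
    (mul_two_mul_add_one_add_lt (finrank_pos_of_nonempty Φ₁) (finrank_pos_of_nonempty Φ₂))

/-- **PRODUCTS ARE NEVER HODGE-GENERAL: `Hg(X₁ × X₂) ≠ Sp(V₁ ⊕ V₂, E₁ ⊞ E₂)` for polarised complex tori of
dimensions `g₁, g₂ ≥ 1`** (product polarisation `p₁^*E₁ + p₂^*E₂`) — `𝔥𝔤_ℝ(X₁ × X₂) ⊆ 𝔥𝔤_ℝ(X₁) ⊕ 𝔥𝔤_ℝ(X₂)` is too
small, by the dimension criterion of g17-#1. [cite: GreenGriffithsKerr2012, §III.B (i) (p. 72: "`M_{φ₁+φ₂} ⊂ M_{φ₁} × M_{φ₂}`")]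
[cite: Lange2023AbelianVarietiesComplex, §7.3.1, proof of Prop. 7.3.2 (pp. 337–338)] -/
theorem IsRiemannForm.hodgeGroup_prod_ne_spGroup [FiniteDimensional ℂ E₁] [FiniteDimensional ℂ E₂] [Nonempty ι₁]
    [Nonempty ι₂] {ω₁ : E₁ [⋀^Fin 2]→L[ℝ] ℝ} {ω₂ : E₂ [⋀^Fin 2]→L[ℝ] ℝ} (h₁ : IsRiemannForm Φ₁ ω₁)
    (h₂ : IsRiemannForm Φ₂ ω₂) :
    hodgeGroup (prodPeriod Φ₁ Φ₂) ≠ spGroup (prodPeriod Φ₁ Φ₂) (prodForm ω₁ ω₂) :=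
  (h₁.prod h₂).hodgeGroup_ne_spGroup_iff_finrank_hodgeGroupLie_lt.2 (h₁.finrank_hodgeGroupLie_prod_lt h₂)

end NotGeneral

/-! ## §4 The case `g = 1`, first half: `|ι| = 2`, `dim_ℝ 𝔰𝔭(V, E) = 3` -/

section DimensionOne

variable {ι : Type*} [Fintype ι] [DecidableEq ι] (Φ : (ι → ℝ) ≃L[ℝ] ℂ)

omit [DecidableEq ι] in
include Φ in
/-- `|ι| = 2` for a one-dimensional complex torus `X = ℂ/Φ(ℤ^ι)`. [cite: Lange2023AbelianVarietiesComplex, §1.1.1] -/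
theorem card_eq_two_of_dimOne : Fintype.card ι = 2 := by
  rw [card_eq_two_mul_finrank Φ, Module.finrank_self]

/-- **`dim_ℝ 𝔰𝔭(V, E) = 3` for a polarised one-dimensional torus** (g17-#1's `g(2g+1)` at `g = 1`).
[cite: BolsinovFomenko2004, Ch. 1 §1.1 Prop. 1.3 (a) (`n = 1`)] -/
theorem IsRiemannForm.finrank_skewAdjointMatricesSubmodule_latticeGram_of_dimOne {η : ℂ [⋀^Fin 2]→L[ℝ] ℝ}
    (hη : IsRiemannForm Φ η) : finrank ℝ (skewAdjointMatricesSubmodule (latticeGram Φ η)) = 3 := by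
  rw [hη.finrank_skewAdjointMatricesSubmodule_latticeGram, Module.finrank_self]

end DimensionOne

end ComplexTorus

end Literature.Geometry.Kaehler
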